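import Summits.QuantumFields.GaugeBoot.PeriodicPlaquetteAdjacency
import Literature.MathematicalPhysics.QuantumFieldTheory.LatticeRPMechanism
import HarnessLib

/-!
# Partial partition functions on a periodic lattice and the factorisation of detached plaquettes (gauge-boot, L3 supplement: uniform reduced-half window, 2/6)

HONEST FRAMING (cell `pub-gaugeboot`, page 1 of every file): the venture produces certified bounds
on lattice expectations at stated coupling, gauge group, dimension and torus size; NOT a mass gap,
NOT a continuum limit, NOT a string tension; NOT Yang–Mills-summit-bearing (barriers
`FixedCouplingUltralocality`, `PerturbativeInvisibility`). This module is bookkeeping for a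
structural NEGATIVE result (a coupling window UNIFORM in the box for the failure of the reduced-half
in-plane reflection positivities of the square tilted boxes in `d ≥ 3`); it discharges nothing by
itself.

## Content (any periodic lattice `(A, e)`: finite additive site group `A`, marked translations `e`; compact metrisable `G`, continuous `ρ`, real `β`)

The periodic-lattice version of the cubic-torus module `DiagonalRPTorusRestPartition` (which is
written for `(ℤ/L)^d` only): the analytic half of the resummation that makes a small-`β` window
of a localised strong-coupling expansion uniform in the volume. With `g_q = e^{β Re tr ρ(U_q)} - 1`
(`PairExp.gfac`) and the pair terms `T_Q(u,v)` (`PairExp.pairT`) of `PeriodicPairTerms`: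

* `gint Q = ∫ ∏_{q ∈ Q} g_q`, `restZ V = ∫ ∏_{q ∈ V} e^{β Re tr ρ(U_q)}` (a PARTIAL partition
  function: only the plaquettes of `V` are switched on); **`restZ_pos`**, the trivial ratio bounds
  **`restZ_le_exp_mul_restZ_of_subset`** / **`restZ_le_exp_mul_restZ_of_superset`**
  (`e^{-|β| N m} ≤ restZ V / restZ W ≤ e^{|β| N m}` for `V ⊆ W`, `m = #(W ∖ V)`: each Boltzmann
  factor lies in `[e^{-|β|N}, e^{|β|N}]` — no cluster expansion), and the resummation
  **`sum_gint_powerset`**: `Σ_{Q ⊆ V} gint Q = restZ V` (`∏ (1 + g_q) = ∏ e^{β Re tr}`).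
* DEPENDENCE ON LINKS: `Re tr ρ(U_q)` and `g_q` read only the links of `q`
  (`dependsOn_plaqObs`, `dependsOn_gfac`, `dependsOn_prod_gfac`), and the product Haar measure
  factorises over disjoint link sets (`integral_mul_eq_of_dependsOn_real`, the real form of
  `LatticeRP.integral_mul_eq_of_dependsOn`). Hence **`pairT_union_eq_mul`**:
  `T_{Q₁ ⊔ Q₂}(u,v) = T_{Q₁}(u,v) · gint Q₂` when the links of `Q₂` avoid those of `u, v, Q₁`, and
  the RESUMMED form **`sum_pairT_union_eq`**: for `Q₁ ⊆ P` and the links of `u, v` inside `K`,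
  `Σ_{Q₂ ⊆ P ∖ snbhd P Q₁} T_{Q₁ ∪ Q₂}(u,v) = T_{Q₁}(u,v) · restZ (P ∖ snbhd P Q₁)`, where `snbhd`
  is the seeded neighbourhood of the polymer calculus (`PolymerCombinatorics`) for the adjacency
  `padj e` and the seeds `Touch e K` of `PeriodicPlaquetteAdjacency`.

Elementary; no named fact (cf. Osterwalder–Seiler, Ann. Phys. 110 (1978) 440, §3, for the
polymer representation this serves).
-/

open MeasureTheory Finset Function

namespace Summit.QuantumFields.GaugeBoot

open Literature.MathematicalPhysics.QuantumFieldTheory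

noncomputable section

namespace TiltedRP

namespace PairExp

variable {A : Type*} [AddCommGroup A] [Fintype A] [DecidableEq A] {d N : ℕ} {G : Type*} [Group G]
  [TopologicalSpace G] [IsTopologicalGroup G] [CompactSpace G] [MeasurableSpace G] [BorelSpace G]
  [SecondCountableTopology G] (ρ : G →* Matrix (Fin N) (Fin N) ℂ) (e : Fin d → A) (β : ℝ)

/-! ## Partial partition functions -/

/-- The GAS INTEGRAL of a set of plaquette factors on the periodic lattice:
`gint Q = ∫ ∏_{q ∈ Q} g_q ∏ dU`. -/
def gint (Q : Finset (Plaq A d)) : ℝ :=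
  ∫ U, ∏ q ∈ Q, gfac ρ e β q U ∂(productHaar A d G)

/-- The PARTIAL PARTITION FUNCTION of the periodic lattice
`restZ V = ∫ ∏_{q ∈ V} e^{β Re tr ρ(U_q)} ∏ dU` (only the plaquettes of `V` switched on). -/
def restZ (V : Finset (Plaq A d)) : ℝ :=
  ∫ U, ∏ q ∈ V, Real.exp (β * plaqObs ρ e q U) ∂(productHaar A d G)

omit [Fintype A] [DecidableEq A] [MeasurableSpace G] [BorelSpace G] [SecondCountableTopology G]
  [CompactSpace G] in
/-- The Boltzmann product is continuous. -/
theorem continuous_expProd (hρ : Continuous ρ) (V : Finset (Plaq A d)) :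
    Continuous fun U : Config A d G => ∏ q ∈ V, Real.exp (β * plaqObs ρ e q U) :=
  continuous_finsetProd _ fun q _ =>
    Real.continuous_exp.comp (continuous_const.mul (continuous_plaqObs ρ hρ e q))

omit [Fintype A] [DecidableEq A] [MeasurableSpace G] [BorelSpace G] [SecondCountableTopology G]
  [CompactSpace G] in
/-- The gas product is continuous. -/
theorem continuous_gProd (hρ : Continuous ρ) (Q : Finset (Plaq A d)) :
    Continuous fun U : Config A d G => ∏ q ∈ Q, gfac ρ e β q U :=
  continuous_finsetProd _ fun q _ => continuous_gfac ρ e β hρ q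

omit [Fintype A] [DecidableEq A] [MeasurableSpace G] [BorelSpace G] [SecondCountableTopology G] in
/-- **Each Boltzmann product lies in `[e^{-|β| N #V}, e^{|β| N #V}]`.** -/
theorem expProd_mem (hρ : Continuous ρ) (V : Finset (Plaq A d)) (U : Config A d G) :
    Real.exp (-(|β| * N * V.card)) ≤ ∏ q ∈ V, Real.exp (β * plaqObs ρ e q U) ∧
      ∏ q ∈ V, Real.exp (β * plaqObs ρ e q U) ≤ Real.exp (|β| * N * V.card) := by
  rw [← Real.exp_sum]
  have hx : ∀ q ∈ V, |β * plaqObs ρ e q U| ≤ |β| * N := fun q _ => by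
    rw [abs_mul]
    exact mul_le_mul_of_nonneg_left (abs_plaqObs_le ρ hρ e q U) (abs_nonneg _)
  have hs : |∑ q ∈ V, β * plaqObs ρ e q U| ≤ |β| * N * V.card := by
    refine (abs_sum_le_sum_abs _ _).trans ?_
    refine (sum_le_sum hx).trans ?_
    rw [sum_const, nsmul_eq_mul]
    ring_nf
    rfl
  rw [abs_le] at hs
  exact ⟨Real.exp_le_exp.2 hs.1, Real.exp_le_exp.2 hs.2⟩

omit [DecidableEq A] in
/-- **Partial partition functions are bounded below**: `restZ V ≥ e^{-|β| N #V}`. -/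
theorem exp_le_restZ (hρ : Continuous ρ) (V : Finset (Plaq A d)) :
    Real.exp (-(|β| * N * V.card)) ≤ restZ ρ e β V := by
  unfold restZ
  have h := integral_mono (μ := productHaar A d G)
    (integrable_const (Real.exp (-(|β| * N * V.card))))
    (TwistedSlab.integrable_config_of_continuous (continuous_expProd ρ e β hρ V))
    fun U => (expProd_mem ρ e β hρ V U).1
  rwa [integral_const, probReal_univ, one_smul] at h

omit [DecidableEq A] in
/-- `0 < restZ V`. -/
theorem restZ_pos (hρ : Continuous ρ) (V : Finset (Plaq A d)) : 0 < restZ ρ e β V :=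
  (Real.exp_pos _).trans_le (exp_le_restZ ρ e β hρ V)

/-- **Switching plaquettes on costs at most `e^{|β| N}` each**: for `V ⊆ W` with
`m = #(W ∖ V)`, `restZ W ≤ e^{|β| N m} · restZ V`. -/
theorem restZ_le_exp_mul_restZ_of_subset (hρ : Continuous ρ) {V W : Finset (Plaq A d)}
    (hVW : V ⊆ W) :
    restZ ρ e β W ≤ Real.exp (|β| * N * (W \ V).card) * restZ ρ e β V := by
  unfold restZ
  rw [← integral_const_mul]
  refine integral_mono (TwistedSlab.integrable_config_of_continuous (continuous_expProd ρ e β hρ W))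
    ((TwistedSlab.integrable_config_of_continuous (continuous_expProd ρ e β hρ V)).const_mul _)
    fun U => ?_
  dsimp only
  rw [← prod_sdiff hVW]
  have h0 : 0 ≤ ∏ q ∈ V, Real.exp (β * plaqObs ρ e q U) := prod_nonneg fun _ _ => Real.exp_nonneg _
  exact mul_le_mul_of_nonneg_right (expProd_mem ρ e β hρ (W \ V) U).2 h0

/-- **Switching plaquettes off costs at most `e^{|β| N}` each**: for `V ⊆ W` with
`m = #(W ∖ V)`, `restZ V ≤ e^{|β| N m} · restZ W`. -/
theorem restZ_le_exp_mul_restZ_of_superset (hρ : Continuous ρ) {V W : Finset (Plaq A d)}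
    (hVW : V ⊆ W) :
    restZ ρ e β V ≤ Real.exp (|β| * N * (W \ V).card) * restZ ρ e β W := by
  unfold restZ
  rw [← integral_const_mul]
  refine integral_mono (TwistedSlab.integrable_config_of_continuous (continuous_expProd ρ e β hρ V))
    ((TwistedSlab.integrable_config_of_continuous (continuous_expProd ρ e β hρ W)).const_mul _)
    fun U => ?_
  dsimp only
  rw [← prod_sdiff hVW]
  have h0 : 0 ≤ ∏ q ∈ V, Real.exp (β * plaqObs ρ e q U) := prod_nonneg fun _ _ => Real.exp_nonneg _
  have h1 := (expProd_mem ρ e β hρ (W \ V) U).1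
  have h2 : Real.exp (|β| * N * (W \ V).card) * Real.exp (-(|β| * N * (W \ V).card)) = 1 := by
    rw [← Real.exp_add, add_neg_cancel, Real.exp_zero]
  calc ∏ q ∈ V, Real.exp (β * plaqObs ρ e q U)
      = Real.exp (|β| * N * (W \ V).card) * (Real.exp (-(|β| * N * (W \ V).card)) *
          ∏ q ∈ V, Real.exp (β * plaqObs ρ e q U)) := by rw [← mul_assoc, h2, one_mul]
    _ ≤ Real.exp (|β| * N * (W \ V).card) * ((∏ q ∈ W \ V, Real.exp (β * plaqObs ρ e q U)) *
          ∏ q ∈ V, Real.exp (β * plaqObs ρ e q U)) :=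
        mul_le_mul_of_nonneg_left (mul_le_mul_of_nonneg_right h1 h0) (Real.exp_nonneg _)

omit [DecidableEq A] in
/-- **Resummation**: `Σ_{Q ⊆ V} gint Q = restZ V` (expand `∏ (1 + g_q)`). -/
theorem sum_gint_powerset (hρ : Continuous ρ) (V : Finset (Plaq A d)) :
    ∑ Q ∈ V.powerset, gint ρ e β Q = restZ ρ e β V := by
  unfold gint restZ
  rw [← integral_finsetSum _ fun Q _ =>
    TwistedSlab.integrable_config_of_continuous (continuous_gProd ρ e β hρ Q)]
  refine integral_congr_ae (ae_of_all _ fun U => ?_)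
  dsimp only
  rw [← restW_eq_sum_prod_gfac ρ e β V U]
  rfl

/-! ## Dependence on links and factorisation -/

omit [Fintype A] [TopologicalSpace G] [IsTopologicalGroup G] [CompactSpace G] [MeasurableSpace G]
  [BorelSpace G] [SecondCountableTopology G] in
/-- `Re tr ρ(U_q)` reads only the links of `q`. -/
theorem dependsOn_plaqObs (q : Plaq A d) :
    DependsOn (fun U : Config A d G => plaqObs ρ e q U) (plinks e q : Set (Link A d)) :=
  fun _ _ h => plaqObs_congr_plink e ρ q fun a => h _ (mem_coe.2 (plink_mem_plinks e q a))

omit [Fintype A] [TopologicalSpace G] [IsTopologicalGroup G] [CompactSpace G] [MeasurableSpace G]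
  [BorelSpace G] [SecondCountableTopology G] in
/-- `g_q` reads only the links of `q`. -/
theorem dependsOn_gfac (q : Plaq A d) :
    DependsOn (fun U : Config A d G => gfac ρ e β q U) (plinks e q : Set (Link A d)) :=
  fun _ _ h => by
    have h1 := dependsOn_plaqObs (G := G) ρ e q h
    dsimp only at h1 ⊢
    unfold gfac
    rw [h1]

omit [Fintype A] [TopologicalSpace G] [IsTopologicalGroup G] [CompactSpace G] [MeasurableSpace G]
  [BorelSpace G] [SecondCountableTopology G] in
/-- A product of plaquette factors reads only the links of its plaquettes (and of any larger link
set). -/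
theorem dependsOn_prod_gfac {Q : Finset (Plaq A d)} {T : Finset (Link A d)}
    (hT : linksOf e Q ⊆ T) :
    DependsOn (fun U : Config A d G => ∏ q ∈ Q, gfac ρ e β q U) (T : Set (Link A d)) :=
  fun _ _ h => prod_congr rfl fun q hq => dependsOn_gfac ρ e β q fun ℓ hℓ =>
    h ℓ (mem_coe.2 (hT (plinks_subset_linksOf hq (mem_coe.1 hℓ))))

omit [Fintype A] [TopologicalSpace G] [IsTopologicalGroup G] [CompactSpace G] [MeasurableSpace G]
  [BorelSpace G] [SecondCountableTopology G] in
/-- The pair integrand `Re tr ρ(U_u) Re tr ρ(U_v) ∏_{Q} g_q` reads only the links of `u, v, Q`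
(and of any larger link set). -/
theorem dependsOn_pairIntegrand {Q : Finset (Plaq A d)} {u v : Plaq A d}
    {S : Finset (Link A d)} (hu : plinks e u ⊆ S) (hv : plinks e v ⊆ S) (hQ : linksOf e Q ⊆ S) :
    DependsOn (fun U : Config A d G =>
      plaqObs ρ e u U * plaqObs ρ e v U * ∏ q ∈ Q, gfac ρ e β q U) (S : Set (Link A d)) := by
  intro U V h
  have h1 := dependsOn_plaqObs (G := G) ρ e u fun ℓ hℓ => h ℓ (mem_coe.2 (hu (mem_coe.1 hℓ)))
  have h2 := dependsOn_plaqObs (G := G) ρ e v fun ℓ hℓ => h ℓ (mem_coe.2 (hv (mem_coe.1 hℓ)))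
  have h3 := dependsOn_prod_gfac (G := G) ρ e β hQ h
  dsimp only at h1 h2 h3 ⊢
  rw [h1, h2, h3]

omit [AddCommGroup A] [SecondCountableTopology G] in
/-- **Independence of disjoint link blocks of the periodic lattice** (real-valued form of
`LatticeRP.integral_mul_eq_of_dependsOn` for the product Haar measure `productHaar A d G`). -/
theorem integral_mul_eq_of_dependsOn_real (S T : Finset (Link A d)) (hST : Disjoint S T)
    {f g : Config A d G → ℝ} (hf : Measurable f) (hg : Measurable g)
    (hfS : DependsOn f (S : Set (Link A d))) (hgT : DependsOn g (T : Set (Link A d))) :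
    ∫ U, f U * g U ∂(productHaar A d G) =
      (∫ U, f U ∂(productHaar A d G)) * ∫ U, g U ∂(productHaar A d G) := by
  have h : ∫ U, (f U : ℂ) * (g U : ℂ) ∂(productHaar A d G) =
      (∫ U, (f U : ℂ) ∂(productHaar A d G)) * ∫ U, (g U : ℂ) ∂(productHaar A d G) := by
    unfold productHaar
    exact LatticeRP.integral_mul_eq_of_dependsOn (haarProbability G) S T hST
      (f := fun U => (f U : ℂ)) (g := fun U => (g U : ℂ)) (Complex.measurable_ofReal.comp hf)
      (Complex.measurable_ofReal.comp hg) (fun U V hUV => by simp only [hfS hUV])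
      (fun U V hUV => by simp only [hgT hUV])
  simp only [← Complex.ofReal_mul, integral_complex_ofReal] at h
  exact_mod_cast h

/-- **Factorisation of detached plaquettes.** If `Q₁`, `Q₂` are disjoint and the links of `Q₂`
avoid the links of `u`, `v` and `Q₁`, then `T_{Q₁ ∪ Q₂}(u,v) = T_{Q₁}(u,v) · gint Q₂`. -/
theorem pairT_union_eq_mul (hρ : Continuous ρ) {Q₁ Q₂ : Finset (Plaq A d)}
    {u v : Plaq A d} (hdisj : Disjoint Q₁ Q₂)
    (hlinks : Disjoint (plinks e u ∪ plinks e v ∪ linksOf e Q₁) (linksOf e Q₂)) :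
    pairT ρ e β (Q₁ ∪ Q₂) u v = pairT ρ e β Q₁ u v * gint ρ e β Q₂ := by
  unfold pairT gint
  have hfac := integral_mul_eq_of_dependsOn_real (G := G) (plinks e u ∪ plinks e v ∪ linksOf e Q₁)
    (linksOf e Q₂) hlinks (continuous_pairIntegrand ρ e β hρ Q₁ u v).measurable
    (continuous_gProd ρ e β hρ Q₂).measurable
    (dependsOn_pairIntegrand ρ e β (subset_union_left.trans subset_union_left)
      (subset_union_right.trans subset_union_left) subset_union_right)
    (dependsOn_prod_gfac ρ e β Subset.rfl)
  rw [← hfac]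
  refine integral_congr_ae (ae_of_all _ fun U => ?_)
  dsimp only
  rw [prod_union hdisj]
  ring

/-- ★ **The resummed factorisation.** Let `K` be a link set containing the links of `u` and `v`,
`P` a set of plaquettes and `Q₁ ⊆ P`. Summing over the plaquette sets `Q₂` avoiding the seeded
neighbourhood of `Q₁` (no link of `K`, no link shared with `Q₁`):
`Σ_{Q₂ ⊆ P ∖ snbhd P Q₁} T_{Q₁ ∪ Q₂}(u,v) = T_{Q₁}(u,v) · restZ (P ∖ snbhd P Q₁)`. -/
theorem sum_pairT_union_eq (hρ : Continuous ρ) {K : Finset (Link A d)}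
    {P Q₁ : Finset (Plaq A d)} (hQ₁ : Q₁ ⊆ P) {u v : Plaq A d} (hu : plinks e u ⊆ K)
    (hv : plinks e v ⊆ K) :
    ∑ Q₂ ∈ (P \ Polymer.snbhd (padj e) (Touch e K) P Q₁).powerset, pairT ρ e β (Q₁ ∪ Q₂) u v =
      pairT ρ e β Q₁ u v * restZ ρ e β (P \ Polymer.snbhd (padj e) (Touch e K) P Q₁) := by
  rw [← sum_gint_powerset ρ e β hρ, mul_sum]
  refine sum_congr rfl fun Q₂ hQ₂ => ?_
  rw [mem_powerset] at hQ₂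
  refine pairT_union_eq_mul ρ e β hρ (Polymer.disjoint_of_subset_sdiff_snbhd hQ₁ hQ₂) ?_
  have h := disjoint_linksOf_of_subset_sdiff_snbhd hQ₂
  exact h.mono_left (union_subset (union_subset (hu.trans subset_union_left)
    (hv.trans subset_union_left)) subset_union_right)

end PairExp

end TiltedRP

end

end Summit.QuantumFields.GaugeBoot
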